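import Literature.NumberTheory.Automorphic.FuchsianEichlerShimuraWeightTwo
import Mathlib.NumberTheory.ModularForms.Bounds
import Mathlib.NumberTheory.ModularForms.QExpansion
import HarnessLib

/-!
# Weight-two cusp forms with vanishing real periods vanish — the cusped (arithmetic) case
# (Shimura Thm. 8.4, injectivity half, for an arithmetic subgroup)

Topic `NumberTheory/Automorphic`; THEOREMS ONLY (no definition, no named fact, no instance, no notation, no
`sorry`).  Filed by the BSD ideator seat `bsd-idea-10` (gen 22, lens = transfer) for the crux `EulerHalvesAtThree`
(`stmt-BirchSwinnertonDyer-19109`), NUM node `CartanOnePlaceDegreeLawAtThree` (`stmt-BirchSwinnertonDyer-24801`),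
line of record `Cruxes/CartanOnePlaceDegreeLawAtThree/Lines/lattice.lean`: it is the analytic heart of the
split-algebra injectivity residue
`Literature.NumberTheory.Automorphic.eichlerShimura_weightTwo_rePeriod_injective_of_exists_not_isUnit`
(`FuchsianEichlerShimuraWeightTwo.lean`; the (ESᶜ-inj-split) clause of
`eichlerShimura_weightTwo_rePeriod_of_residue`), to which it applies once the norm-one group of an order in a
*split* rational quaternion algebra has been conjugated onto a subgroup containing an arithmetic group.

HONEST FRAMING.  Nothing in this file proves a summit statement, the crux, the NUM node or the residue itself, and
the Birch–Swinnerton-Dyer conjecture is proved here for no curve.  What is proved is a self-contained theorem about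
weight-two cusp forms for an *arithmetic* subgroup `Γ ≤ GL₂(ℝ)` (`Subgroup.IsArithmetic`: commensurable with the
image of `SL₂(ℤ)`):

* `CuspForm.eq_zero_of_forall_rePeriod_eq_zero_of_isArithmetic` — if `Γ` is arithmetic with `det = 1` and every
  real period `Re ∫_{z₀}^{γ z₀} F(z) dz` (`γ ∈ Γ`) of a weight-two cusp form `F` on `Γ` vanishes, then `F = 0`
  (Shimura Thm. 8.4 at `n = 0`, injectivity of `F ↦ (Re ∫_{z₀}^{γ z₀} F)_γ`, in the case WITH cusps).

On the way (namespace `Literature.NumberTheory.Automorphic`, all for `G : CuspForm Γ 2`, `Γ` arbitrary, `h > 0` a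
strict period of `Γ`):

* `CuspForm.coe_eq_zero_of_re_segmentIntegral_le'` — maximum principle on `ℍ` for `u = Re ∫_{τ₁}^{τ} G`;
* `CuspForm.periodic_segmentIntegral_comp_ofComplex'` — the primitive is `h`-periodic;
* `CuspForm.isBoundedAtImInfty_segmentIntegral'` — **the primitive of a cusp form is bounded at `i∞`** (exponential
  decay `CuspFormClass.exp_decay_atImInfty` integrated along a vertical ray with the Gronwall-type bound
  `image_norm_le_of_norm_deriv_right_le_deriv_boundary`, plus periodicity);
* `CuspForm.tendsto_segmentIntegral_atImInfty'` — hence it has a limit at `i∞`, the value at the centre of the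
  `q`-disc of its cusp function (`UpperHalfPlane.differentiableOn_cuspFunction_ball`);
* `CuspForm.coe_eq_zero_of_re_segmentIntegral_le_cuspValue'` — maximum principle at the cusp: if `u` is bounded by
  its limit value at `i∞` then `G = 0` (maximum modulus for `exp ∘ cuspFunction` on the unit `q`-disc).

TRANSFER (the lens).  This is the cusped counterpart of the cocompact argument already in the tree
(`QuaternionOrderUnitsCocompact.lean` §3; Summit-side `…CartanCoverPrintClausesCocompact`): the `Γ`-invariant
harmonic function `u = Re ∫_{z₀}^{τ} F` is bounded (`ModularGroup.exists_bound_of_subgroup_invariant`, fed by the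
limits at the cusps `g • i∞`, `g ∈ SL₂(ℤ)`, of `u ∘ g` obtained from the translated forms `F ∣[2] g`), and its
supremum is either attained in `ℍ` (maximum principle on `ℍ`), or equal to a cusp value (maximum principle on the
`q`-disc), or approached nowhere — the last excluded by compactness of the truncated fundamental domain
(`ModularGroup.isCompact_truncatedFundamentalDomain`) and finiteness of `SL₂(ℤ) ⧸ (Γ ∩ SL₂(ℤ))`.  The one step of
the cocompact proof that does not transfer verbatim — behaviour at the cusps — is exactly what the `q`-disc lemmas
above supply.

DEVIATION.  The transformation rule `Ψ(γτ) = Ψ(τ) + Ψ(γ z₀)` is re-proved here as a `private` lemma (it exists as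
`segmentIntegral_smul_eq_add_period` in `ShimuraCurvePeriodsHeckeIntegralityProofs.lean`, a module outside this
file's build closure, and privately in `QuaternionOrderUnitsCocompact.lean`).

## References

* [ShimuraIATAF1971] G. Shimura, *Introduction to the arithmetic theory of automorphic functions* (1971): §1.3–1.5
  (cusps of Fuchsian groups of the first kind, the local parameter `q = e^{2πiz/h}` at a cusp, Prop. 1.31), §2.1
  (holomorphy at cusps), Thm. 8.4 p. 234 (the real-period isomorphism), §9.2 p. 246.
* [DiamondShurman2005] F. Diamond, J. Shurman, *A First Course in Modular Forms*, GTM 228: §1.2 (holomorphy at `∞`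
  via the `q`-disc and the removable-singularity criterion).
-/

set_option autoImplicit false

noncomputable section

open scoped MatrixGroups ModularForm Topology Manifold Pointwise
open UpperHalfPlane hiding I
open Filter Set ConjAct Matrix.SpecialLinearGroup

namespace Literature.NumberTheory.Automorphic

/-! ## The maximum principle for the primitive of a weight-two cusp form -/

section Analytic

variable {Γ : Subgroup (GL (Fin 2) ℝ)}

/-- If `exp (∫_{τ₁}^{τ} G)` is constant on `ℍ`, then `G = 0` (differentiate).
[folklore] -/
private theorem CuspForm.coe_eq_zero_of_cexp_segmentIntegral_eq' (G : CuspForm Γ 2) (τ₁ : ℍ) (c : ℂ)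
    (hc : ∀ τ : ℍ, Complex.exp (segmentIntegral G τ₁ τ) = c) : (⇑G : ℍ → ℂ) = 0 := by
  funext τ
  have hτ : 0 < (τ : ℂ).im := τ.im_pos
  have hd1 : HasDerivAt (fun z : ℂ => Complex.exp ((segmentIntegral G τ₁ ∘ ofComplex) z))
      (Complex.exp ((segmentIntegral G τ₁ ∘ ofComplex) (τ : ℂ)) * G (ofComplex (τ : ℂ)))
      (τ : ℂ) :=
    (hasDerivAt_segmentIntegral G τ₁ hτ).cexp
  have hconst : (fun z : ℂ => Complex.exp ((segmentIntegral G τ₁ ∘ ofComplex) z)) =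
      fun _ => c := funext fun z => hc (ofComplex z)
  have hd2 : HasDerivAt (fun z : ℂ => Complex.exp ((segmentIntegral G τ₁ ∘ ofComplex) z))
      0 (τ : ℂ) := by
    rw [hconst]; exact hasDerivAt_const _ _
  have h0 := hd1.unique hd2
  rw [ofComplex_apply] at h0
  rcases mul_eq_zero.mp h0 with h1 | h1
  · exact absurd h1 (Complex.exp_ne_zero _)
  · simpa using h1

/-- Maximum principle on `ℍ`: if `Re ∫_{τ₁}^{τ} G` attains its maximum at an interior point
`k ∈ ℍ`, then `G = 0`.
[folklore] -/
private theorem CuspForm.coe_eq_zero_of_re_segmentIntegral_le' (G : CuspForm Γ 2) (τ₁ k : ℍ)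
    (hmax : ∀ τ : ℍ, (segmentIntegral G τ₁ τ).re ≤ (segmentIntegral G τ₁ k).re) :
    (⇑G : ℍ → ℂ) = 0 := by
  have hdiff : DifferentiableOn ℂ (segmentIntegral G τ₁ ∘ ofComplex) {z : ℂ | 0 < z.im} :=
    differentiableOn_segmentIntegral G τ₁
  set f : ℂ → ℂ := fun z => Complex.exp ((segmentIntegral G τ₁ ∘ ofComplex) z) with hfdef
  have hfd : DifferentiableOn ℂ f {z : ℂ | 0 < z.im} := hdiff.cexp
  have hkU : (k : ℂ) ∈ {z : ℂ | 0 < z.im} := k.im_pos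
  have hfmax : IsMaxOn (norm ∘ f) {z : ℂ | 0 < z.im} (k : ℂ) := by
    intro z hz
    have hz' : 0 < z.im := hz
    simp only [Function.comp_apply, hfdef, Complex.norm_exp, Set.mem_setOf_eq]
    refine Real.exp_le_exp.mpr ?_
    rw [ofComplex_apply, ofComplex_apply_of_im_pos hz']
    exact hmax _
  have hconst := Complex.eqOn_of_isPreconnected_of_isMaxOn_norm
    (convex_halfSpace_im_gt 0).isPreconnected isOpen_upperHalfPlaneSet hfd hkU hfmax
  refine CuspForm.coe_eq_zero_of_cexp_segmentIntegral_eq' G τ₁ (f k) fun τ => ?_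
  have h := hconst (τ.im_pos : (τ : ℂ) ∈ {z : ℂ | 0 < z.im})
  simpa [hfdef, ofComplex_apply] using h

/-- The primitive `∫_{τ₁}^{·} G ∘ ofComplex` is `h`-periodic when `h` is a strict period of the
level.
[folklore] -/
private theorem CuspForm.periodic_segmentIntegral_comp_ofComplex' (G : CuspForm Γ 2) {h : ℝ} (hh : 0 < h)
    (hΓ : h ∈ Γ.strictPeriods) (τ₁ : ℍ) :
    Function.Periodic (segmentIntegral G τ₁ ∘ ofComplex) h := by
  haveI : Fact (IsCusp OnePoint.infty Γ) := ⟨Γ.isCusp_of_mem_strictPeriods hh hΓ⟩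
  have h0 : IsZeroAtImInfty (⇑G : ℍ → ℂ) := CuspFormClass.zero_at_infty G
  have hper : ∀ w : ℍ, G (h +ᵥ w) = G w := fun w =>
    SlashInvariantForm.vAdd_apply_of_mem_strictPeriods G w hΓ
  intro w
  by_cases hw : 0 < w.im
  · have hw' : 0 < (w + h).im := by simpa using hw
    have e : ofComplex (w + h) = h +ᵥ ofComplex w := by
      apply UpperHalfPlane.ext
      rw [ofComplex_apply_of_im_pos hw', ofComplex_apply_of_im_pos hw, coe_vadd,
        UpperHalfPlane.coe_mk, UpperHalfPlane.coe_mk, add_comm]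
    have hsub := segmentIntegral_sub_segmentIntegral G τ₁ (ofComplex w) (ofComplex (w + h))
    rw [e, CuspForm.segmentIntegral_vadd_eq_zero_of_isZeroAtImInfty G hper h0] at hsub
    simp only [Function.comp_apply]
    rw [e]
    exact sub_eq_zero.mp hsub
  · have hw0 : w.im ≤ 0 := not_lt.mp hw
    have hw0' : (w + h).im ≤ 0 := by simpa using hw0
    simp only [Function.comp_apply]
    rw [ofComplex_apply_eq_of_im_nonpos hw0' hw0]

/-- The primitive of a weight-two cusp form is bounded at `i∞` (exponential decay of the cusp
form integrated along a vertical ray, plus periodicity).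
[folklore] -/
private theorem CuspForm.isBoundedAtImInfty_segmentIntegral' (G : CuspForm Γ 2) {h : ℝ} (hh : 0 < h)
    (hΓ : h ∈ Γ.strictPeriods) (τ₁ : ℍ) : IsBoundedAtImInfty (segmentIntegral G τ₁) := by
  obtain ⟨C, hC0, hCw⟩ := (CuspFormClass.exp_decay_atImInfty G hh hΓ).exists_pos
  rw [Asymptotics.IsBigOWith, atImInfty, Filter.eventually_comap, Filter.eventually_atTop]
    at hCw
  obtain ⟨A, hA⟩ := hCw
  set a : ℝ := 2 * Real.pi / h with ha_def
  have ha : 0 < a := div_pos Real.two_pi_pos hh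
  have hbound : ∀ τ : ℍ, A ≤ τ.im → ‖G τ‖ ≤ C * Real.exp (-a * τ.im) := by
    intro τ hτ
    have h1 := hA τ.im hτ τ rfl
    rw [Real.norm_of_nonneg (Real.exp_pos _).le] at h1
    have e : -2 * Real.pi * τ.im / h = -a * τ.im := by rw [ha_def]; ring
    rwa [e] at h1
  set A' : ℝ := max A 1 with hA'def
  have hA'pos : 0 < A' := lt_of_lt_of_le one_pos (le_max_right A 1)
  have hAA' : A ≤ A' := le_max_left A 1
  set Φ : ℂ → ℂ := segmentIntegral G τ₁ ∘ ofComplex with hΦdef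
  have hderiv : ∀ z : ℂ, 0 < z.im → HasDerivAt Φ (G (ofComplex z)) z :=
    fun z hz => hasDerivAt_segmentIntegral G τ₁ hz
  have hGz : ∀ z : ℂ, A' ≤ z.im → ‖G (ofComplex z)‖ ≤ C * Real.exp (-a * z.im) := by
    intro z hz
    have hz0 : 0 < z.im := lt_of_lt_of_le hA'pos hz
    have him : (ofComplex z).im = z.im := by
      rw [ofComplex_apply_of_im_pos hz0, UpperHalfPlane.mk_im]
    have h1 := hbound (ofComplex z) (by rw [him]; exact hAA'.trans hz)
    rw [him] at h1
    exact h1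
  have hper : Function.Periodic Φ h := CuspForm.periodic_segmentIntegral_comp_ofComplex' G hh hΓ τ₁
  -- the constants
  set K : ℝ := C * Real.exp (-a * A') with hKdef
  have hK0 : 0 ≤ K := mul_nonneg hC0.le (Real.exp_pos _).le
  set M : ℝ := ‖Φ ((A' : ℂ) * Complex.I)‖ + K * h + K / a with hMdef
  -- (1) horizontal estimate along `Im z = A'`, `0 ≤ Re z ≤ h`
  have hH : ∀ x ∈ Icc (0 : ℝ) h,
      ‖Φ ((x : ℂ) + (A' : ℂ) * Complex.I) - Φ ((A' : ℂ) * Complex.I)‖ ≤ K * h := by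
    intro x hx
    set fH : ℝ → ℂ := fun s => Φ ((s : ℂ) + (A' : ℂ) * Complex.I) with hfHdef
    have hfH : ∀ s : ℝ,
        HasDerivAt fH (G (ofComplex ((s : ℂ) + (A' : ℂ) * Complex.I))) s := by
      intro s
      have hw : 0 < ((s : ℂ) + (A' : ℂ) * Complex.I).im := by simp [hA'pos]
      have h1 : HasDerivAt (fun z : ℂ => z + (A' : ℂ) * Complex.I) 1 (s : ℂ) :=
        (hasDerivAt_id (s : ℂ)).add_const _
      have h2 := ((hderiv _ hw).comp (s : ℂ) h1).comp_ofReal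
      simpa [hfHdef, Function.comp_def] using h2
    have hseg := norm_image_sub_le_of_norm_deriv_le_segment' (f := fH) (a := 0) (b := h)
      (f' := fun s => G (ofComplex ((s : ℂ) + (A' : ℂ) * Complex.I))) (C := K)
      (fun s _ => (hfH s).hasDerivWithinAt)
      (fun s _ => by
        have him : ((s : ℂ) + (A' : ℂ) * Complex.I).im = A' := by simp
        have h1 := hGz ((s : ℂ) + (A' : ℂ) * Complex.I) him.ge
        rw [him] at h1
        exact h1) x hx
    have e0 : fH 0 = Φ ((A' : ℂ) * Complex.I) := by simp [hfHdef]
    rw [e0, sub_zero] at hseg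
    calc ‖Φ ((x : ℂ) + (A' : ℂ) * Complex.I) - Φ ((A' : ℂ) * Complex.I)‖
        ≤ K * x := hseg
      _ ≤ K * h := mul_le_mul_of_nonneg_left hx.2 hK0
  -- (2) vertical estimate along `Re z = x'`, from height `A'` to height `y`
  have hV : ∀ (x' y : ℝ), A' ≤ y →
      ‖Φ ((x' : ℂ) + (y : ℂ) * Complex.I) - Φ ((x' : ℂ) + (A' : ℂ) * Complex.I)‖ ≤ K / a := by
    intro x' y hy
    set fV : ℝ → ℂ := fun s =>
      Φ ((x' : ℂ) + (s : ℂ) * Complex.I) - Φ ((x' : ℂ) + (A' : ℂ) * Complex.I) with hfVdef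
    have hfV : ∀ s : ℝ, 0 < s →
        HasDerivAt fV (G (ofComplex ((x' : ℂ) + (s : ℂ) * Complex.I)) * Complex.I) s := by
      intro s hs
      have hw : 0 < ((x' : ℂ) + (s : ℂ) * Complex.I).im := by simp [hs]
      have h1 : HasDerivAt (fun z : ℂ => (x' : ℂ) + z * Complex.I) Complex.I (s : ℂ) := by
        simpa using ((hasDerivAt_id (s : ℂ)).mul_const Complex.I).const_add (x' : ℂ)
      have h2 := (((hderiv _ hw).comp (s : ℂ) h1).comp_ofReal).sub_const
        (Φ ((x' : ℂ) + (A' : ℂ) * Complex.I))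
      simpa [hfVdef, Function.comp_def] using h2
    set B : ℝ → ℝ := fun s => C / a * (Real.exp (-a * A') - Real.exp (-a * s)) with hBdef
    set B' : ℝ → ℝ := fun s => C * Real.exp (-a * s) with hB'def
    have hB : ∀ s : ℝ, HasDerivAt B (B' s) s := by
      intro s
      have h1 : HasDerivAt (fun s : ℝ => -a * s) (-a) s := by
        simpa using (hasDerivAt_id s).const_mul (-a)
      have h2 : HasDerivAt (fun s : ℝ => Real.exp (-a * s)) (Real.exp (-a * s) * (-a)) s :=
        h1.exp
      have h3 := ((hasDerivAt_const s (Real.exp (-a * A'))).sub h2).const_mul (C / a)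
      have h4 : C / a * (0 - Real.exp (-a * s) * (-a)) = B' s := by
        have ha' : a ≠ 0 := ha.ne'
        simp only [hB'def]
        calc C / a * (0 - Real.exp (-a * s) * (-a))
            = C * Real.exp (-a * s) * (a / a) := by ring
          _ = C * Real.exp (-a * s) := by rw [div_self ha', mul_one]
      rw [h4] at h3
      exact h3
    have hcont : ContinuousOn fV (Icc A' y) := fun s hs =>
      (hfV s (lt_of_lt_of_le hA'pos hs.1)).continuousAt.continuousWithinAt
    have hder : ∀ s ∈ Ico A' y, HasDerivWithinAt fV
        (G (ofComplex ((x' : ℂ) + (s : ℂ) * Complex.I)) * Complex.I) (Ici s) s :=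
      fun s hs => (hfV s (lt_of_lt_of_le hA'pos hs.1)).hasDerivWithinAt
    have hBa : ‖fV A'‖ ≤ B A' := by simp [hfVdef, hBdef]
    have hbd : ∀ s ∈ Ico A' y,
        ‖G (ofComplex ((x' : ℂ) + (s : ℂ) * Complex.I)) * Complex.I‖ ≤ B' s := by
      intro s hs
      rw [norm_mul, Complex.norm_I, mul_one]
      have him : ((x' : ℂ) + (s : ℂ) * Complex.I).im = s := by simp
      have h1 := hGz ((x' : ℂ) + (s : ℂ) * Complex.I) (by rw [him]; exact hs.1)
      rw [him] at h1
      exact h1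
    have hres := image_norm_le_of_norm_deriv_right_le_deriv_boundary hcont hder hBa hB hbd
      (x := y) ⟨hy, le_rfl⟩
    calc ‖Φ ((x' : ℂ) + (y : ℂ) * Complex.I) - Φ ((x' : ℂ) + (A' : ℂ) * Complex.I)‖
        = ‖fV y‖ := by simp [hfVdef]
      _ ≤ B y := hres
      _ = C / a * (Real.exp (-a * A') - Real.exp (-a * y)) := by simp [hBdef]
      _ ≤ C / a * Real.exp (-a * A') := by
          apply mul_le_mul_of_nonneg_left _ (div_nonneg hC0.le ha.le)
          linarith [Real.exp_pos (-a * y)]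
      _ = K / a := by rw [hKdef]; ring
  -- (3) assemble, reducing `Re z` modulo the period `h`
  refine isBoundedAtImInfty_iff.mpr ⟨M, A', fun τ hτ => ?_⟩
  have hτ0 : 0 < (τ : ℂ).im := τ.im_pos
  set x : ℝ := (τ : ℂ).re with hxdef
  set y : ℝ := (τ : ℂ).im with hydef
  have hyA : A' ≤ y := hτ
  set n : ℤ := ⌊x / h⌋ with hndef
  set x' : ℝ := x - n * h with hx'def
  have hx'eq : x' = Int.fract (x / h) * h := by
    rw [hx'def, ← Int.self_sub_floor, sub_mul, div_mul_cancel₀ x hh.ne']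
  have hx'0 : 0 ≤ x' := by rw [hx'eq]; exact mul_nonneg (Int.fract_nonneg _) hh.le
  have hx'h : x' ≤ h := by
    rw [hx'eq]
    have := Int.fract_lt_one (x / h)
    nlinarith
  have hzeq : (τ : ℂ) = ((x' : ℂ) + (y : ℂ) * Complex.I) + (n : ℂ) * (h : ℂ) := by
    apply Complex.ext <;> simp [hx'def, hxdef, hydef]
  have hΦτ : segmentIntegral G τ₁ τ = Φ ((x' : ℂ) + (y : ℂ) * Complex.I) := by
    have e1 : segmentIntegral G τ₁ τ = Φ (τ : ℂ) := by simp [hΦdef, ofComplex_apply]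
    rw [e1, hzeq]
    exact hper.int_mul n _
  rw [hΦτ]
  have h1 := hH x' ⟨hx'0, hx'h⟩
  have h2 := hV x' y hyA
  calc ‖Φ ((x' : ℂ) + (y : ℂ) * Complex.I)‖
      = ‖Φ ((A' : ℂ) * Complex.I)
          + (Φ ((x' : ℂ) + (A' : ℂ) * Complex.I) - Φ ((A' : ℂ) * Complex.I))
          + (Φ ((x' : ℂ) + (y : ℂ) * Complex.I) - Φ ((x' : ℂ) + (A' : ℂ) * Complex.I))‖ := by
        congr 1; ring
    _ ≤ ‖Φ ((A' : ℂ) * Complex.I)‖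
          + ‖Φ ((x' : ℂ) + (A' : ℂ) * Complex.I) - Φ ((A' : ℂ) * Complex.I)‖
          + ‖Φ ((x' : ℂ) + (y : ℂ) * Complex.I) - Φ ((x' : ℂ) + (A' : ℂ) * Complex.I)‖ :=
        norm_add₃_le
    _ ≤ ‖Φ ((A' : ℂ) * Complex.I)‖ + K * h + K / a := by linarith
    _ = M := by rw [hMdef]

/-- The primitive of a weight-two cusp form has a limit at `i∞`, namely the value at the centre
of the `q`-disc of its cusp function.
[folklore] -/
private theorem CuspForm.tendsto_segmentIntegral_atImInfty' (G : CuspForm Γ 2) {h : ℝ} (hh : 0 < h)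
    (hΓ : h ∈ Γ.strictPeriods) (τ₁ : ℍ) :
    Tendsto (segmentIntegral G τ₁) atImInfty
      (𝓝 (cuspFunction h (segmentIntegral G τ₁) 0)) := by
  have hper := CuspForm.periodic_segmentIntegral_comp_ofComplex' G hh hΓ τ₁
  have hhol := UpperHalfPlane.mdifferentiable_iff.mpr (differentiableOn_segmentIntegral G τ₁)
  have hbdd := CuspForm.isBoundedAtImInfty_segmentIntegral' G hh hΓ τ₁
  have hcont : ContinuousAt (cuspFunction h (segmentIntegral G τ₁)) 0 :=
    (differentiableOn_cuspFunction_ball hh hper hhol hbdd).continuousOn.continuousAt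
      (Metric.ball_mem_nhds (0 : ℂ) one_pos)
  have heq : (cuspFunction h (segmentIntegral G τ₁) ∘ fun τ : ℍ =>
      Function.Periodic.qParam h (τ : ℂ)) = segmentIntegral G τ₁ := by
    funext τ
    simpa using eq_cuspFunction τ hh.ne' hper
  simpa only [heq] using hcont.tendsto.comp (qParam_tendsto_atImInfty hh)

/-- Maximum principle at the cusp `i∞`: if `Re ∫_{τ₁}^{τ} G` is everywhere bounded by its limit
value at `i∞`, then `G = 0`.
[folklore] -/
private theorem CuspForm.coe_eq_zero_of_re_segmentIntegral_le_cuspValue' (G : CuspForm Γ 2) {h : ℝ} (hh : 0 < h)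
    (hΓ : h ∈ Γ.strictPeriods) (τ₁ : ℍ)
    (hle : ∀ τ : ℍ, (segmentIntegral G τ₁ τ).re ≤ (cuspFunction h (segmentIntegral G τ₁) 0).re) :
    (⇑G : ℍ → ℂ) = 0 := by
  have hper := CuspForm.periodic_segmentIntegral_comp_ofComplex' G hh hΓ τ₁
  have hhol := UpperHalfPlane.mdifferentiable_iff.mpr (differentiableOn_segmentIntegral G τ₁)
  have hbdd := CuspForm.isBoundedAtImInfty_segmentIntegral' G hh hΓ τ₁
  have hcf : DifferentiableOn ℂ (cuspFunction h (segmentIntegral G τ₁)) (Metric.ball 0 1) :=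
    differentiableOn_cuspFunction_ball hh hper hhol hbdd
  set f : ℂ → ℂ := fun q => Complex.exp (cuspFunction h (segmentIntegral G τ₁) q) with hfdef
  have hfd : DifferentiableOn ℂ f (Metric.ball 0 1) := hcf.cexp
  have h0U : (0 : ℂ) ∈ Metric.ball (0 : ℂ) 1 := Metric.mem_ball_self one_pos
  have hfmax : IsMaxOn (norm ∘ f) (Metric.ball 0 1) 0 := by
    intro q hq
    simp only [Function.comp_apply, hfdef, Complex.norm_exp, Set.mem_setOf_eq]
    refine Real.exp_le_exp.mpr ?_
    rcases eq_or_ne q 0 with rfl | hq'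
    · exact le_rfl
    · have hq1 : ‖q‖ < 1 := mem_ball_zero_iff.mp hq
      set τ : ℍ := ⟨Function.Periodic.invQParam h q,
        Function.Periodic.im_invQParam_pos_of_norm_lt_one hh hq1 hq'⟩ with hτdef
      have hqτ : Function.Periodic.qParam h (τ : ℂ) = q :=
        Function.Periodic.qParam_right_inv hh.ne' hq'
      rw [← hqτ, eq_cuspFunction τ hh.ne' hper]
      exact hle τ
  have hconst := Complex.eqOn_of_isPreconnected_of_isMaxOn_norm
    (convex_ball (0 : ℂ) 1).isPreconnected Metric.isOpen_ball hfd h0U hfmax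
  refine CuspForm.coe_eq_zero_of_cexp_segmentIntegral_eq' G τ₁ (f 0) fun τ => ?_
  have hτq : Function.Periodic.qParam h (τ : ℂ) ∈ Metric.ball (0 : ℂ) 1 :=
    mem_ball_zero_iff.mpr (Function.Periodic.norm_qParam_lt_one hh τ.im_pos)
  have h := hconst hτq
  simp only [hfdef, Function.const_apply, eq_cuspFunction τ hh.ne' hper] at h
  exact h

end Analytic

/-! ## Transformation of the primitive under the level and under `SL₂(ℤ)` -/

section Transformation

variable {Γ : Subgroup (GL (Fin 2) ℝ)}

/-- For `γ ∈ Γ` (a `det = 1` level) the primitive transforms by a period: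
`Ψ(γτ) = Ψ(τ) + Ψ(γ z₀)`.
[folklore] [cite: ShimuraIATAF1971, §8.2 (8.2.19)–(8.2.20)] -/
private theorem segmentIntegral_smul_eq_add_period' [Γ.HasDetOne] (F : CuspForm Γ 2)
    {γ : GL (Fin 2) ℝ} (hγ : γ ∈ Γ) (z₀ τ : ℍ) :
    segmentIntegral F z₀ (γ • τ) = segmentIntegral F z₀ τ + segmentIntegral F z₀ (γ • z₀) := by
  have hdet1 : γ.det = 1 := Subgroup.HasDetOne.det_eq hγ
  have hdet : 0 < (γ.det : ℝ) := by rw [hdet1]; simp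
  have hinv : segmentIntegral F (γ • z₀) (γ • τ) = segmentIntegral F z₀ τ := by
    rw [← segmentIntegral_slash_eq F hdet z₀ τ]
    have h := SlashInvariantForm.slash_action_eqn F γ hγ
    have h' : (⇑F : ℍ → ℂ) ∣[(2 : ℤ)] γ = ⇑F := by simpa using h
    rw [h']
  have hsplit := segmentIntegral_sub_segmentIntegral F z₀ (γ • z₀) (γ • τ)
  rw [hinv] at hsplit
  linear_combination hsplit

/-- Translation by `g ∈ SL₂(ℤ)`: the primitive of `F` along `g • τ` is a constant plus the
primitive of the translated cusp form `F ∣[2] g`.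
[folklore] -/
private theorem segmentIntegral_sl_smul' (F : CuspForm Γ 2) (g : SL(2, ℤ)) (z₀ τ₁ τ : ℍ) :
    segmentIntegral F z₀ ((g : GL (Fin 2) ℝ) • τ) =
      segmentIntegral F z₀ ((g : GL (Fin 2) ℝ) • τ₁)
        + segmentIntegral (CuspForm.translate F (g : GL (Fin 2) ℝ)) τ₁ τ := by
  have hg : 0 < ((g : GL (Fin 2) ℝ).det : ℝ) := by
    rw [Matrix.SpecialLinearGroup.coeToGL_det]; simp
  have e := segmentIntegral_sub_segmentIntegral F z₀ ((g : GL (Fin 2) ℝ) • τ₁)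
    ((g : GL (Fin 2) ℝ) • τ)
  rw [← segmentIntegral_slash_eq F hg τ₁ τ] at e
  have hcoe : (⇑(CuspForm.translate F (g : GL (Fin 2) ℝ)) : ℍ → ℂ) =
      ⇑F ∣[(2 : ℤ)] (g : GL (Fin 2) ℝ) := rfl
  rw [hcoe]
  linear_combination e

end Transformation

/-! ## The theorem: vanishing real periods force vanishing (arithmetic level) -/

section Main

variable {Γ : Subgroup (GL (Fin 2) ℝ)} [Γ.IsArithmetic] [Γ.HasDetOne]

/-- **Injectivity of the real-period map, cusped case.**  Let `Γ ≤ GL₂(ℝ)` be an arithmetic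
subgroup with `det = 1` and `F` a weight-two cusp form on `Γ`.  If every real period
`Re ∫_{z₀}^{γ z₀} F(z) dz`, `γ ∈ Γ`, vanishes, then `F = 0`.
[cite: ShimuraIATAF1971, Thm. 8.4 p. 234; §1.5; §9.2 p. 246] -/
theorem CuspForm.eq_zero_of_forall_rePeriod_eq_zero_of_isArithmetic (z₀ : ℍ) (F : CuspForm Γ 2)
    (hF : ∀ γ : Γ, CuspForm.rePeriod F z₀ γ = 0) : F = 0 := by
  -- the `Γ`-invariant harmonic function `u = Re Ψ`, `Ψ = ∫_{z₀}^{·} F`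
  set u : ℍ → ℝ := fun τ => (segmentIntegral F z₀ τ).re with hudef
  have hinv : ∀ γ ∈ Γ, ∀ τ : ℍ, u (γ • τ) = u τ := by
    intro γ hγ τ
    have hp := hF ⟨γ, hγ⟩
    rw [CuspForm.rePeriod_apply] at hp
    simp only [hudef]
    rw [segmentIntegral_smul_eq_add_period' F hγ z₀ τ, Complex.add_re]
    simpa using hp
  have hΨc : Continuous (segmentIntegral F z₀) := by
    have h2 : segmentIntegral F z₀ = (segmentIntegral F z₀ ∘ ofComplex) ∘ ((↑) : ℍ → ℂ) := by
      funext τ; simp [ofComplex_apply]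
    rw [h2]
    exact (differentiableOn_segmentIntegral F z₀).continuousOn.comp_continuous continuous_coe
      fun τ => τ.im_pos
  have huc : Continuous u := Complex.continuous_re.comp hΨc
  have hcoeF : ∀ h0 : (⇑F : ℍ → ℂ) = 0, F = 0 := fun h0 =>
    DFunLike.coe_injective (h0.trans CuspForm.coe_zero.symm)
  -- behaviour at the cusp `g • i∞` for every `g ∈ SL₂(ℤ)`
  have key : ∀ g : SL(2, ℤ), ∃ ℓ : ℝ,
      Tendsto (fun τ : ℍ => u ((g : GL (Fin 2) ℝ) • τ)) atImInfty (𝓝 ℓ) ∧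
        ((∀ τ : ℍ, u τ ≤ ℓ) → F = 0) := by
    intro g
    haveI hΓg : ((toConjAct (g : GL (Fin 2) ℝ)⁻¹) • Γ).IsArithmetic := by
      simpa [(show Rat.castHom ℝ = algebraMap ℚ ℝ by rfl), map_inv, map_mapGL]
        using! Subgroup.IsArithmetic.conj Γ (mapGL ℚ g)⁻¹
    set Γg : Subgroup (GL (Fin 2) ℝ) := (toConjAct (g : GL (Fin 2) ℝ)⁻¹) • Γ with hΓg_def
    set G : CuspForm Γg 2 := CuspForm.translate F (g : GL (Fin 2) ℝ) with hGdef
    have hh : 0 < Γg.strictWidthInfty := Γg.strictWidthInfty_pos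
    have hmem : Γg.strictWidthInfty ∈ Γg.strictPeriods := Γg.strictWidthInfty_mem_strictPeriods
    set c : ℝ := (segmentIntegral F z₀ ((g : GL (Fin 2) ℝ) • z₀)).re with hcdef
    have hrel : ∀ τ : ℍ, u ((g : GL (Fin 2) ℝ) • τ) = c + (segmentIntegral G z₀ τ).re := by
      intro τ
      simp only [hudef, hcdef, hGdef]
      rw [segmentIntegral_sl_smul' F g z₀ z₀ τ, Complex.add_re]
    have hlim := CuspForm.tendsto_segmentIntegral_atImInfty' G hh hmem z₀
    set L : ℂ := cuspFunction Γg.strictWidthInfty (segmentIntegral G z₀) 0 with hLdef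
    refine ⟨c + L.re, ?_, fun hle => ?_⟩
    · have ht : Tendsto (fun τ : ℍ => c + (segmentIntegral G z₀ τ).re) atImInfty
          (𝓝 (c + L.re)) :=
        tendsto_const_nhds.add ((Complex.continuous_re.tendsto L).comp hlim)
      exact ht.congr fun τ => (hrel τ).symm
    · have hle' : ∀ τ : ℍ, (segmentIntegral G z₀ τ).re ≤ L.re := by
        intro τ
        have h1 := hle ((g : GL (Fin 2) ℝ) • τ)
        rw [hrel τ] at h1
        linarith
      have hG0 : (⇑G : ℍ → ℂ) = 0 :=
        CuspForm.coe_eq_zero_of_re_segmentIntegral_le_cuspValue' G hh hmem z₀ hle'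
      have hcoe : (⇑G : ℍ → ℂ) = ⇑F ∣[(2 : ℤ)] (g : GL (Fin 2) ℝ) := rfl
      refine hcoeF ?_
      have h2 : (⇑F : ℍ → ℂ) =
          ((⇑F : ℍ → ℂ) ∣[(2 : ℤ)] (g : GL (Fin 2) ℝ)) ∣[(2 : ℤ)] (g : GL (Fin 2) ℝ)⁻¹ := by
        rw [← SlashAction.slash_mul, mul_inv_cancel, SlashAction.slash_one]
      rw [h2, ← hcoe, hG0, SlashAction.zero_slash]
  choose ℓ hℓ hℓF using key
  -- `u` is bounded
  obtain ⟨C, hC⟩ : ∃ C, ∀ τ, ‖u τ‖ ≤ C :=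
    ModularGroup.exists_bound_of_subgroup_invariant huc (fun g => (hℓ g).isBigO_one ℝ) hinv
  set S : ℝ := sSup (Set.range u) with hSdef
  have hbdd : BddAbove (Set.range u) :=
    ⟨C, by rintro _ ⟨τ, rfl⟩; exact (le_abs_self _).trans (hC τ)⟩
  have hleS : ∀ τ, u τ ≤ S := fun τ => le_csSup hbdd ⟨τ, rfl⟩
  -- (A) the supremum is attained in `ℍ`
  by_cases hA : ∃ k : ℍ, u k = S
  · obtain ⟨k, hk⟩ := hA
    refine hcoeF (CuspForm.coe_eq_zero_of_re_segmentIntegral_le' F z₀ k fun τ => ?_)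
    have := hleS τ
    simp only [hudef] at hk this
    rw [hk]
    exact this
  -- (B) the supremum is a cusp value
  by_cases hB : ∃ g : SL(2, ℤ), ℓ g = S
  · obtain ⟨g, hg⟩ := hB
    exact hℓF g fun τ => by rw [hg]; exact hleS τ
  -- (C) otherwise: contradiction with compactness modulo `SL₂(ℤ)`
  exfalso
  push Not at hA hB
  have hltS : ∀ k, u k < S := fun k => lt_of_le_of_ne (hleS k) (hA k)
  have hℓlt : ∀ g, ℓ g < S := fun g =>
    lt_of_le_of_ne (le_of_tendsto' (hℓ g) fun τ => hleS _) (hB g)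
  set Γ' : Subgroup SL(2, ℤ) := Γ.comap (mapGL ℝ) with hΓ'def
  haveI : Fintype (SL(2, ℤ) ⧸ Γ') := Subgroup.fintypeQuotientOfFiniteIndex
  haveI : Nonempty (SL(2, ℤ) ⧸ Γ') := ⟨((1 : SL(2, ℤ)) : SL(2, ℤ) ⧸ Γ')⟩
  -- near each cusp, `u ∘ g` stays strictly below `S`
  have hev : ∀ g : SL(2, ℤ), ∃ Y : ℝ, ∀ τ : ℍ, Y ≤ τ.im →
      u ((g : GL (Fin 2) ℝ) • τ) < (ℓ g + S) / 2 := by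
    intro g
    have hlt : ℓ g < (ℓ g + S) / 2 := by linarith [hℓlt g]
    obtain ⟨Y, hY⟩ := (atImInfty_mem _).mp ((hℓ g).eventually (gt_mem_nhds hlt))
    exact ⟨Y, fun τ hτ => hY τ hτ⟩
  choose Y hY using hev
  obtain ⟨Y₀, hY₀⟩ : ∃ Y₀ : ℝ, ∀ q : SL(2, ℤ) ⧸ Γ', Y (Quotient.out q)⁻¹ ≤ Y₀ := by
    obtain ⟨Y₀, hY₀⟩ := (Set.finite_range fun q : SL(2, ℤ) ⧸ Γ' => Y (Quotient.out q)⁻¹).bddAbove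
    exact ⟨Y₀, fun q => hY₀ ⟨q, rfl⟩⟩
  -- on the compact truncated fundamental domain, `u ∘ g` attains a maximum `< S`
  have hcpt : ∀ g : SL(2, ℤ), ∃ m : ℝ, m < S ∧
      ∀ τ ∈ ModularGroup.truncatedFundamentalDomain Y₀, u ((g : GL (Fin 2) ℝ) • τ) ≤ m := by
    intro g
    rcases (ModularGroup.truncatedFundamentalDomain Y₀).eq_empty_or_nonempty with he | hne
    · refine ⟨S - 1, by linarith, fun τ hτ => ?_⟩
      rw [he] at hτ
      exact absurd hτ (Set.notMem_empty _)
    · have hcont : ContinuousOn (fun τ : ℍ => u ((g : GL (Fin 2) ℝ) • τ))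
          (ModularGroup.truncatedFundamentalDomain Y₀) :=
        (huc.comp (continuous_const_smul (g : GL (Fin 2) ℝ))).continuousOn
      obtain ⟨k, -, hkmax⟩ :=
        (ModularGroup.isCompact_truncatedFundamentalDomain Y₀).exists_isMaxOn hne hcont
      exact ⟨u ((g : GL (Fin 2) ℝ) • k), hltS _, fun τ hτ => hkmax hτ⟩
  choose m hmS hm using hcpt
  obtain ⟨q₀, hq₀⟩ := Finite.exists_max fun q : SL(2, ℤ) ⧸ Γ' =>
    max (m (Quotient.out q)⁻¹) ((ℓ (Quotient.out q)⁻¹ + S) / 2)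
  set S₁ : ℝ := max (m (Quotient.out q₀)⁻¹) ((ℓ (Quotient.out q₀)⁻¹ + S) / 2) with hS₁def
  have hS₁S : S₁ < S := max_lt (hmS _) (by linarith [hℓlt (Quotient.out q₀)⁻¹])
  have hall : ∀ τ : ℍ, u τ ≤ S₁ := by
    intro τ
    obtain ⟨g₀, hg₀⟩ := ModularGroup.exists_smul_mem_fd τ
    set q : SL(2, ℤ) ⧸ Γ' := (g₀ : SL(2, ℤ) ⧸ Γ') with hqdef
    have hj : g₀⁻¹ * Quotient.out q ∈ Γ' :=
      QuotientGroup.eq.mp (QuotientGroup.out_eq' q).symm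
    have hmemΓ : mapGL ℝ ((Quotient.out q)⁻¹ * g₀) ∈ Γ := by
      have e : (Quotient.out q)⁻¹ * g₀ = (g₀⁻¹ * Quotient.out q)⁻¹ := by group
      rw [e]
      exact Subgroup.mem_comap.mp (Γ'.inv_mem hj)
    have hu : u τ = u (((Quotient.out q)⁻¹ * g₀ : SL(2, ℤ)) • τ) := by
      rw [ModularGroup.sl_moeb]
      exact (hinv _ hmemΓ τ).symm
    rw [hu, mul_smul]
    set τ' : ℍ := g₀ • τ with hτ'def
    by_cases hcase : Y₀ ≤ τ'.im
    · have h1 := hY (Quotient.out q)⁻¹ τ' ((hY₀ q).trans hcase)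
      have h2 : (ℓ (Quotient.out q)⁻¹ + S) / 2 ≤ S₁ := (le_max_right _ _).trans (hq₀ q)
      rw [ModularGroup.sl_moeb]
      linarith
    · push Not at hcase
      have hmem' : τ' ∈ ModularGroup.truncatedFundamentalDomain Y₀ := ⟨hg₀, hcase.le⟩
      have h1 := hm (Quotient.out q)⁻¹ τ' hmem'
      have h2 : m (Quotient.out q)⁻¹ ≤ S₁ := (le_max_left _ _).trans (hq₀ q)
      rw [ModularGroup.sl_moeb]
      linarith
  have hSle : S ≤ S₁ := csSup_le (Set.range_nonempty u) (by rintro _ ⟨τ, rfl⟩; exact hall τ)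
  linarith

end Main

end Literature.NumberTheory.Automorphic

end
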